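import Literature.AnabelianGeometry.Anabelioids.Basic
import Mathlib.CategoryTheory.Galois.Examples
import Mathlib.Topology.Algebra.OpenSubgroup
import HarnessLib

/-!
# Induction for `B(G)`: the equivalence `B(G)_{G/U} ≌ B(U)` for an open subgroup `U ⊆ G`

For a topological group `G`, `B(G)` = finite sets with continuous `G`-action (the tree's
`Frobenioids.BCat G` = Mathlib `ContAction FintypeCat G`), and an open subgroup `U ⊆ G` of finite
index, the finite `G`-set `G/U` is an object `S = G ⧸ₐ U` of `B(G)`, and **taking the fibre over the
base coset `eU`** is an equivalence of categories

  `B(G)_S = Over S ≌ B(U)`,  `(B → G/U) ↦ B_{eU}` with its `U`-action,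

whose quasi-inverse is **induction** `T ↦ (G ×_U T → G/U)`.  This is the standard dictionary
"finite étale coverings of `B(G)` trivialised over `G/U` ↔ finite `U`-sets" behind [GeoAn]
Remark 1.2.2.1 ("`B(H) → B(G)` is finite étale iff `H → G` is an open injection", S. Mochizuki,
*The geometry of anabelioids*, Publ. RIMS 40 (2004), p. 17 [cite: MochizukiGeoAn2004, Rem. 1.2.2.1 p.17])
and [SemiAnbd] §2 (finite étale coverings of a connected anabelioid `B(Π)` ↔ open subgroups of
`Π`); SGA1 V §6 in the classical setting.

Contents of this file (all constructions explicit, Mathlib `ContAction` framework):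
* `Induction.quotObj U hU : BCat G` — the coset object `G ⧸ₐ U` (continuity: stabilisers are the
  open conjugates of `U`), `Induction.basePt`;
* `Induction.Fiber f` — the fibre of `f : B → G/U` over `eU`, a finite continuous `U`-set
  (`fiberObj`), and the functor `Induction.fiber U hU : Over (quotObj U hU) ⥤ BCat U`;
* `Induction.extend` / `Induction.lift` — extension of a `U`-map of fibres to a `G`-map over `G/U`
  (`b ↦ g • v(g⁻¹ • b)` for `f(b) = gU`, independent of `g`), whence the fibre functor is FULL
  (`full_fiber`) and FAITHFUL (`faithful_fiber`).

The sequel `InductionEquivalence.lean` constructs the induced `G`-set `G ×_U T`, proves essential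
surjectivity and assembles the equivalence `Over (quotObj U hU) ≌ BCat U`; the compatibility with
restriction (`Over.star`) and the discharge of `bCat_res_isFiniteEtale_iff` follow it.
-/

noncomputable section

namespace Literature.AnabelianGeometry.Anabelioids

open CategoryTheory CategoryTheory.Limits
open Literature.AlgebraicGeometry.Frobenioids (BCat)
open scoped FintypeCatDiscrete Pointwise

universe u

namespace Induction

variable {G : Type u} [Group G] [TopologicalSpace G] [IsTopologicalGroup G]

/-! ### Generalities on `B(G)` -/

/-- A finite `G`-set is continuous iff every stabiliser is open (Mathlib's
`continuousSMul_iff_stabilizer_isOpen` for the discrete topology). [cite: MochizukiGeoAn2004, Rem. 1.2.2.1 p.17] -/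
theorem isContinuous_iff (X : Action FintypeCat.{u} G) :
    Action.IsContinuous X ↔ ∀ x : X.V, IsOpen (MulAction.stabilizer G x : Set G) := by
  constructor
  · intro h
    have h' : ContinuousSMul G X.V := h
    exact continuousSMul_iff_stabilizer_isOpen.mp h'
  · intro h
    have h' : ContinuousSMul G X.V := continuousSMul_iff_stabilizer_isOpen.mpr h
    exact h'

omit [TopologicalSpace G] [IsTopologicalGroup G] in
/-- Equivariance of a morphism of finite `G`-sets, pointwise. [cite: MochizukiGeoAn2004, Rem. 1.2.2.1 p.17] -/
theorem hom_smul {X Y : Action FintypeCat.{u} G} (f : X ⟶ Y) (g : G) (x : X.V) :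
    f.hom (g • x) = g • f.hom x := by
  have e := ConcreteCategory.congr_hom (f.comm g) x
  simp only [FintypeCat.comp_apply] at e
  exact e

/-! ### The coset object `G/U` -/

variable (U : Subgroup G) [Finite (G ⧸ U)]

/-- Stabilisers in the coset `G`-set `G/U` of an open subgroup are open (they are the conjugates
`gUg⁻¹`). [cite: MochizukiGeoAn2004, Rem. 1.2.2.1 p.17] -/
theorem isContinuous_quot (hU : IsOpen (U : Set G)) : Action.IsContinuous (G ⧸ₐ U) := by
  rw [isContinuous_iff]
  intro q
  obtain ⟨g₀, hg₀⟩ := QuotientGroup.mk_surjective (q : G ⧸ U)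
  have key : (MulAction.stabilizer G q : Set G) = (fun g : G => g₀⁻¹ * g * g₀) ⁻¹' (U : Set G) := by
    ext g
    simp only [SetLike.mem_coe, MulAction.mem_stabilizer_iff, Set.mem_preimage]
    rw [← hg₀]
    change (g • (g₀ : G ⧸ U) : G ⧸ U) = (g₀ : G ⧸ U) ↔ _
    rw [MulAction.Quotient.smul_coe, smul_eq_mul, eq_comm, QuotientGroup.eq, mul_assoc]
  have hopen : IsOpen ((fun g : G => g₀⁻¹ * g * g₀) ⁻¹' (U : Set G)) := hU.preimage (by fun_prop)
  exact (congrArg IsOpen key).mpr hopen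

/-- **The coset object** `S = G/U` of `B(G)` for an open subgroup `U` of finite index
(`G ⧸ₐ U` with its continuity certificate). [cite: MochizukiGeoAn2004, Rem. 1.2.2.1 p.17] -/
def quotObj (hU : IsOpen (U : Set G)) : BCat G := ⟨G ⧸ₐ U, isContinuous_quot U hU⟩

/-- The base coset `eU ∈ G/U` as a point of the coset object. [cite: MochizukiGeoAn2004, Rem. 1.2.2.1 p.17] -/
def basePt (hU : IsOpen (U : Set G)) : (quotObj U hU).obj.V := ((1 : G) : G ⧸ U)

omit [TopologicalSpace G] [IsTopologicalGroup G] [Finite (G ⧸ U)] in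
/-- The action on the coset object is the coset action: `g • (hU) = (gh)U`. [cite: MochizukiGeoAn2004, Rem. 1.2.2.1 p.17] -/
theorem quotObj_smul_mk [Finite (G ⧸ U)] (g h : G) :
    (g • (((h : G ⧸ U)) : (G ⧸ₐ U).V) : (G ⧸ₐ U).V) = (((g * h : G) : G ⧸ U) : (G ⧸ₐ U).V) :=
  rfl

/-! ### The fibre functor `Over (G/U) ⥤ B(U)` -/

variable {U} {hU : IsOpen (U : Set G)}

/-- The fibre `B_{eU} = f⁻¹(eU)` of an object `f : B → G/U` over the coset object.
[cite: MochizukiGeoAn2004, Rem. 1.2.2.1 p.17] -/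
def Fiber (f : Over (quotObj U hU)) : Type u :=
  {b : f.left.obj.V // f.hom.hom.hom b = basePt U hU}

/-- The fibre is finite. [cite: MochizukiGeoAn2004, Rem. 1.2.2.1 p.17] -/
instance (f : Over (quotObj U hU)) : Finite (Fiber f) :=
  Subtype.finite

/-- The structure map is equivariant: `f(g • b) = g • f(b)`. [cite: MochizukiGeoAn2004, Rem. 1.2.2.1 p.17] -/
theorem over_hom_smul (f : Over (quotObj U hU)) (g : G) (b : f.left.obj.V) :
    f.hom.hom.hom (g • b) = g • f.hom.hom.hom b :=
  hom_smul f.hom.hom g b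

/-- `U` acts on the fibre over `eU` (since `u • eU = eU`). [cite: MochizukiGeoAn2004, Rem. 1.2.2.1 p.17] -/
instance (f : Over (quotObj U hU)) : MulAction U (Fiber f) where
  smul u b := ⟨(u : G) • b.1, by
    rw [over_hom_smul, b.2]
    change (((u : G) * 1 : G) : G ⧸ U) = ((1 : G) : G ⧸ U)
    rw [mul_one, QuotientGroup.eq, mul_one, inv_mem_iff]
    exact u.2⟩
  one_smul b := Subtype.ext (one_smul G b.1)
  mul_smul u v b := Subtype.ext (mul_smul (u : G) (v : G) b.1)

/-- Unfolding the `U`-action on the fibre. [cite: MochizukiGeoAn2004, Rem. 1.2.2.1 p.17] -/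
@[simp] theorem Fiber.smul_val (f : Over (quotObj U hU)) (u : U) (b : Fiber f) :
    (u • b).1 = (u : G) • b.1 := rfl

/-- The fibre as a finite `U`-set (an object of `Action FintypeCat U`). [cite: MochizukiGeoAn2004, Rem. 1.2.2.1 p.17] -/
def fiberAction (f : Over (quotObj U hU)) : Action FintypeCat.{u} U :=
  Action.FintypeCat.ofMulAction U (FintypeCat.of (Fiber f))

/-- The `U`-action on the fibre is continuous: the stabiliser of `b` in `U` is the trace of its
(open) stabiliser in `G`. [cite: MochizukiGeoAn2004, Rem. 1.2.2.1 p.17] -/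
theorem isContinuous_fiberAction (f : Over (quotObj U hU)) :
    Action.IsContinuous (fiberAction f) := by
  rw [isContinuous_iff]
  intro b
  have hB : IsOpen (MulAction.stabilizer G ((b : Fiber f).1 : f.left.obj.V) : Set G) :=
    (isContinuous_iff f.left.obj).mp f.left.property b.1
  have key : (MulAction.stabilizer U (b : Fiber f) : Set U) =
      ((↑) : U → G) ⁻¹' (MulAction.stabilizer G ((b : Fiber f).1 : f.left.obj.V) : Set G) := by
    ext u
    simp only [SetLike.mem_coe, MulAction.mem_stabilizer_iff, Set.mem_preimage]
    constructor
    · intro h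
      exact congrArg Subtype.val h
    · intro h
      exact Subtype.ext h
  rw [key]
  exact hB.preimage continuous_subtype_val

/-- The fibre functor on objects: `(f : B → G/U) ↦ B_{eU}` as an object of `B(U)`.
[cite: MochizukiGeoAn2004, Rem. 1.2.2.1 p.17] -/
def fiberObj (f : Over (quotObj U hU)) : BCat U :=
  ⟨fiberAction f, isContinuous_fiberAction f⟩

/-- A morphism over `G/U` maps fibres to fibres. [cite: MochizukiGeoAn2004, Rem. 1.2.2.1 p.17] -/
theorem left_mem_fiber {f f' : Over (quotObj U hU)} (k : f ⟶ f') (b : Fiber f) :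
    f'.hom.hom.hom (k.left.hom.hom b.1) = basePt U hU := by
  have h := congrArg (fun φ : f.left ⟶ quotObj U hU => φ.hom.hom b.1) (Over.w k)
  simp only [ObjectProperty.FullSubcategory.comp_hom, Action.comp_hom, FintypeCat.comp_apply] at h
  rw [h]
  exact b.2

/-- The fibre functor on morphisms, as a function. [cite: MochizukiGeoAn2004, Rem. 1.2.2.1 p.17] -/
def fiberFun {f f' : Over (quotObj U hU)} (k : f ⟶ f') (b : Fiber f) : Fiber f' :=
  ⟨k.left.hom.hom b.1, left_mem_fiber k b⟩

/-- The fibre function is `U`-equivariant. [cite: MochizukiGeoAn2004, Rem. 1.2.2.1 p.17] -/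
theorem fiberFun_smul {f f' : Over (quotObj U hU)} (k : f ⟶ f') (u : U) (b : Fiber f) :
    fiberFun k (u • b) = u • fiberFun k b := by
  apply Subtype.ext
  change k.left.hom.hom ((u • b).1) = (u : G) • k.left.hom.hom b.1
  rw [Fiber.smul_val]
  exact hom_smul k.left.hom (u : G) b.1

/-- The fibre functor on morphisms. [cite: MochizukiGeoAn2004, Rem. 1.2.2.1 p.17] -/
def fiberMap {f f' : Over (quotObj U hU)} (k : f ⟶ f') : fiberObj f ⟶ fiberObj f' :=
  ObjectProperty.homMk
    { hom := FintypeCat.homMk (fiberFun k)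
      comm := fun u => by
        apply FintypeCat.hom_ext
        intro b
        simp only [FintypeCat.comp_apply, FintypeCat.homMk_apply]
        exact fiberFun_smul k u b }

/-- Unfolding the fibre functor on morphisms, pointwise. [cite: MochizukiGeoAn2004, Rem. 1.2.2.1 p.17] -/
@[simp] theorem fiberMap_apply {f f' : Over (quotObj U hU)} (k : f ⟶ f') (b : Fiber f) :
    (fiberMap k).hom.hom b = fiberFun k b := rfl

variable (U hU) in
/-- **The fibre functor** `B(G)_{G/U} ⥤ B(U)`, `(B → G/U) ↦ B_{eU}`.
[cite: MochizukiGeoAn2004, Rem. 1.2.2.1 p.17] -/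
def fiber : Over (quotObj U hU) ⥤ BCat U where
  obj := fiberObj
  map := fiberMap
  map_id f := by
    apply (ObjectProperty.ι _).map_injective
    apply Action.hom_ext
    apply FintypeCat.hom_ext
    intro b
    apply Subtype.ext
    rfl
  map_comp k k' := by
    apply (ObjectProperty.ι _).map_injective
    apply Action.hom_ext
    apply FintypeCat.hom_ext
    intro b
    apply Subtype.ext
    rfl


/-! ### The fibre functor is fully faithful -/

/-- A representative `g ∈ G` of the coset `f(b) ∈ G/U`. [cite: MochizukiGeoAn2004, Rem. 1.2.2.1 p.17] -/
def rep (f : Over (quotObj U hU)) (b : f.left.obj.V) : G :=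
  Quotient.out (f.hom.hom.hom b : G ⧸ U)

/-- `f(b) = (rep f b) U`. [cite: MochizukiGeoAn2004, Rem. 1.2.2.1 p.17] -/
theorem rep_spec (f : Over (quotObj U hU)) (b : f.left.obj.V) :
    f.hom.hom.hom b = ((rep f b : G) : G ⧸ U) :=
  (Quotient.out_eq (f.hom.hom.hom b : G ⧸ U)).symm

/-- Translating a point `b` with `f(b) = gU` into the fibre over `eU`: `g⁻¹ • b`. [cite: MochizukiGeoAn2004, Rem. 1.2.2.1 p.17] -/
def toFiber (f : Over (quotObj U hU)) (g : G) (b : f.left.obj.V)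
    (h : f.hom.hom.hom b = ((g : G) : G ⧸ U)) : Fiber f :=
  ⟨g⁻¹ • b, by
    rw [over_hom_smul, h]
    change ((((g⁻¹ * g : G) : G ⧸ U)) : (G ⧸ₐ U).V) = basePt U hU
    rw [inv_mul_cancel]
    rfl⟩

/-- Underlying point of `toFiber`: `g⁻¹ • b`. [cite: MochizukiGeoAn2004, Rem. 1.2.2.1 p.17] -/
@[simp] theorem toFiber_val (f : Over (quotObj U hU)) (g : G) (b : f.left.obj.V)
    (h : f.hom.hom.hom b = ((g : G) : G ⧸ U)) : (toFiber f g b h).1 = g⁻¹ • b := rfl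

/-- Pointwise `U`-equivariance of a morphism of fibres. [cite: MochizukiGeoAn2004, Rem. 1.2.2.1 p.17] -/
theorem fiberHom_smul {f f' : Over (quotObj U hU)} (v : fiberObj f ⟶ fiberObj f') (u : U)
    (b : Fiber f) : (v.hom.hom (u • b) : Fiber f') = u • (v.hom.hom b : Fiber f') :=
  hom_smul v.hom u b

/-- **Extension** of a `U`-map of fibres `v : B_{eU} → B'_{eU}` to all of `B`:
`b ↦ g • v(g⁻¹ • b)` where `f(b) = gU` (choice of representative; independence below). [cite: MochizukiGeoAn2004, Rem. 1.2.2.1 p.17] -/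
def extend {f f' : Over (quotObj U hU)} (v : fiberObj f ⟶ fiberObj f') (b : f.left.obj.V) :
    f'.left.obj.V :=
  rep f b • (v.hom.hom (toFiber f (rep f b) b (rep_spec f b)) : Fiber f').1

/-- Independence of the representative: `extend v b = g • v(g⁻¹ • b)` for ANY `g` with
`f(b) = gU` (uses the `U`-equivariance of `v`). [cite: MochizukiGeoAn2004, Rem. 1.2.2.1 p.17] -/
theorem extend_eq {f f' : Over (quotObj U hU)} (v : fiberObj f ⟶ fiberObj f') (b : f.left.obj.V)
    (g : G) (h : f.hom.hom.hom b = ((g : G) : G ⧸ U)) :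
    extend v b = g • (v.hom.hom (toFiber f g b h) : Fiber f').1 := by
  -- `g = g₀ * u` with `g₀` the chosen representative and `u ∈ U`
  set g₀ := rep f b with hg₀
  have hu : g₀⁻¹ * g ∈ U := by
    rw [← QuotientGroup.eq, ← rep_spec f b, h]
  set u : U := ⟨g₀⁻¹ * g, hu⟩ with hu'
  have hg : g = g₀ * (u : G) := by rw [hu']; group
  have key : toFiber f g₀ b (rep_spec f b) = u • toFiber f g b h := by
    apply Subtype.ext
    rw [Fiber.smul_val, toFiber_val, toFiber_val, hg, mul_inv_rev, smul_smul, mul_inv_cancel_left]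
  change g₀ • (v.hom.hom (toFiber f g₀ b (rep_spec f b)) : Fiber f').1 = _
  rw [key, fiberHom_smul]
  change g₀ • ((u : G) • (v.hom.hom (toFiber f g b h) : Fiber f').1) = _
  rw [smul_smul, ← hg]

/-- The extension is `G`-equivariant. [cite: MochizukiGeoAn2004, Rem. 1.2.2.1 p.17] -/
theorem extend_smul {f f' : Over (quotObj U hU)} (v : fiberObj f ⟶ fiberObj f') (x : G)
    (b : f.left.obj.V) : extend v (x • b) = x • extend v b := by
  have h : f.hom.hom.hom (x • b) = (((x * rep f b : G)) : G ⧸ U) := by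
    rw [over_hom_smul, rep_spec f b]
    rfl
  have ht : toFiber f (x * rep f b) (x • b) h = toFiber f (rep f b) b (rep_spec f b) :=
    Subtype.ext (by rw [toFiber_val, toFiber_val, mul_inv_rev, mul_smul, inv_smul_smul])
  rw [extend_eq v (x • b) (x * rep f b) h, extend_eq v b (rep f b) (rep_spec f b), ht, smul_smul]

/-- The extension lies over `G/U`: `f'(extend v b) = f(b)`. [cite: MochizukiGeoAn2004, Rem. 1.2.2.1 p.17] -/
theorem over_extend {f f' : Over (quotObj U hU)} (v : fiberObj f ⟶ fiberObj f') (b : f.left.obj.V) :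
    f'.hom.hom.hom (extend v b) = f.hom.hom.hom b := by
  unfold extend
  rw [over_hom_smul, (v.hom.hom (toFiber f (rep f b) b (rep_spec f b)) : Fiber f').2,
    rep_spec f b]
  change ((((rep f b * 1 : G)) : G ⧸ U) : (G ⧸ₐ U).V) = _
  rw [mul_one]

/-- The extension restricts to `v` on the fibre. [cite: MochizukiGeoAn2004, Rem. 1.2.2.1 p.17] -/
theorem extend_val {f f' : Over (quotObj U hU)} (v : fiberObj f ⟶ fiberObj f') (b : Fiber f) :
    extend v b.1 = (v.hom.hom b : Fiber f').1 := by
  rw [extend_eq v b.1 1 (by rw [b.2]; rfl), one_smul]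
  congr 2
  apply Subtype.ext
  rw [toFiber_val, inv_one, one_smul]

/-- The morphism over `G/U` extending a `U`-map of fibres. [cite: MochizukiGeoAn2004, Rem. 1.2.2.1 p.17] -/
def lift {f f' : Over (quotObj U hU)} (v : fiberObj f ⟶ fiberObj f') : f ⟶ f' :=
  Over.homMk
    (ObjectProperty.homMk
      { hom := FintypeCat.homMk (extend v)
        comm := fun x => by
          apply FintypeCat.hom_ext
          intro b
          simp only [FintypeCat.comp_apply, FintypeCat.homMk_apply]
          exact extend_smul v x b })
    (by
      apply (ObjectProperty.ι _).map_injective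
      apply Action.hom_ext
      apply FintypeCat.hom_ext
      intro b
      simp only [Functor.map_comp]
      exact over_extend v b)

/-- Underlying function of `lift v` is `extend v`. [cite: MochizukiGeoAn2004, Rem. 1.2.2.1 p.17] -/
@[simp] theorem lift_left_apply {f f' : Over (quotObj U hU)} (v : fiberObj f ⟶ fiberObj f')
    (b : f.left.obj.V) : (lift v).left.hom.hom b = extend v b := rfl

variable (U hU) in
/-- The fibre functor is **full**: every `U`-map of fibres extends. [cite: MochizukiGeoAn2004, Rem. 1.2.2.1 p.17] -/
instance full_fiber : (fiber U hU).Full where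
  map_surjective {f f'} v := ⟨lift v, by
    apply (ObjectProperty.ι _).map_injective
    apply Action.hom_ext
    apply FintypeCat.hom_ext
    intro b
    change fiberFun (lift v) b = v.hom.hom b
    apply Subtype.ext
    change (lift v).left.hom.hom b.1 = (v.hom.hom b : Fiber f').1
    rw [lift_left_apply, extend_val]
    rfl⟩

/-- A morphism over `G/U` is determined by its restriction to the fibre over `eU`
(translate by a representative). [cite: MochizukiGeoAn2004, Rem. 1.2.2.1 p.17] -/
theorem left_apply_eq {f f' : Over (quotObj U hU)} (k : f ⟶ f') (b : f.left.obj.V) :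
    k.left.hom.hom b = rep f b • k.left.hom.hom (toFiber f (rep f b) b (rep_spec f b)).1 := by
  rw [toFiber_val, hom_smul k.left.hom, smul_inv_smul]

variable (U hU) in
/-- The fibre functor is **faithful**. [cite: MochizukiGeoAn2004, Rem. 1.2.2.1 p.17] -/
instance faithful_fiber : (fiber U hU).Faithful where
  map_injective {f f'} k k' h := by
    apply Over.OverMorphism.ext
    apply (ObjectProperty.ι _).map_injective
    apply Action.hom_ext
    apply FintypeCat.hom_ext
    intro b
    have hb := congrArg (fun w : fiberObj f ⟶ fiberObj f' =>
      ((w.hom.hom (toFiber f (rep f b) b (rep_spec f b)) : Fiber f')).1) h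
    change ((fiberMap k).hom.hom _).1 = ((fiberMap k').hom.hom _).1 at hb
    rw [fiberMap_apply, fiberMap_apply] at hb
    change k.left.hom.hom _ = k'.left.hom.hom _ at hb
    change k.left.hom.hom b = k'.left.hom.hom b
    rw [left_apply_eq k b, left_apply_eq k' b, hb]

end Induction

end Literature.AnabelianGeometry.Anabelioids

end
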